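import Summits.QuantumFields.BalabanUV.T4Continuum.Support.ShellMeasureLandauEndAssembledDecayCfLinV6
import Summits.QuantumFields.BalabanUV.T4Continuum.Support.ShellMeasureCoTestStarShaped

/-!
v6 RE-ROOT (owner R-ne7cp1-g37-1 (c3) «THE MIDDLE», unit `b2b-balaban-t4-ne7c-formalise-leaf-03` gen 9; chain suffix `V6`∕`_v6`,
R-ne7cp1-g37-3 (b)): THIS MODULE IS `ShellMeasureLandauEndAssembledDecayCfLinCoTests` (ROW S104 f4, leaf-10-g13) REGENERATED MECHANICALLY over link 4 `ShellMeasureLandauEndAssembledDecayCfLinV6` — the chain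
rooted at leaf-07-g10's S112 f3 `ShellMeasureLandauEndRayStokesAssembledDecayV6` (the Wilson budgets `hqW hk` in print's (53)–(54)
field-size shape, S112; the 𝓔-leg read on the w-tuple's pinned dress, S113 = leaf-01-g11's `ShellMeasureRayTermsPinnedLandauW`) — by
`g9/src/relink/relink.py` (the old surgery re-applied to the new host; ONE BY-NAME call; conclusion = the host's).  BINDER DIFF vs `ShellMeasureLandauEndAssembledDecayCfLinCoTests` (`linkdiff.py` on the bytes):
LEAVE = `Se Se' h52loce ϖe₁ ϖe₂ hϖe₁ hϖe₂ r₀e hreache Λe 𝔄 δ' ϖ hδ' hϖ 𝒵e ℬe 𝒢e W𝒱e B₀e C₄e a₃e be h𝒢e hWe hB₀e hC₄e hbe H₁e hH₁e Te rΦe hTbe hSre ιe hιe He hHe`;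
ENTER = `hϖ0 hB𝒢w hBH₁w hBHw hιew`; TYPE-CHANGED = `hqW hk hdome hselfe hcontre hqe hRCe Ef hEb supp hblind hdepth hK hcoupE hElb₁ hRdict`; conclusion = the
host's re-spelled slot constant.  No hand edit in this link.
HONEST (c3): re-wiring of OUR typed chain; nothing of Bałaban's asserted, cited or discharged; every CONTENT row stays displayed; NOTHING
in the countdown moves; NE7c NOT PRINTED, NOT PROVED; spine 0∕9.  THE OLD MODULE's DOCSTRING FOLLOWS VERBATIM FOR PROVENANCE (read
«imports X» as «imports X·V6»; its LEAVING∕ENTERING lists describe the OLD step, unchanged relative to the v6 host).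
# `T4Continuum.ShellMeasureLandauEndAssembledDecayCfLinCoTests` — «WALL ROW R05 RE-SOURCED ON THE LINEAR-CHART HOST»: S104 f2's
# most-assembled one-slot END (R11 + R10 supplied) RE-FIRED with its window and kept co-tests := THE NEIGHBOURS' KEPT
# (2.17)-INDICATORS ON THE S-BALL (S94) — `hJW hJ hJ1 hWS` DISCHARGED by star-shapedness; in their place the per-neighbour
# (AN-bound)_i + (SM)_i families, displayed; everything else VERBATIM; conclusion IDENTICAL
(cell `pub-balaban`, sub-cell `t4`, spine estimate NE7c (node U5b); NE7c ROUND-2 crew `t4-ne7c-formalise-*`, unit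
`b2b-balaban-t4-ne7c-formalise-leaf-10` gen 13; owner table `t4/b2b-balaban-t4-ne7c-p1/LEAVES-NE7c-P1.md` row **S104 f4** «R05 (W-e)
RE-SOURCED ON THE LINEAR-CHART HOST» (this seat's question Q-ne7cL10g13-1 (A), journal l.21585, after leaf-07-g9's XREAD INFO-2
C-ne7cleaf07g9-3; owner GO R-ne7cp1-g36-8 (A)(i) l.21593 with the four header items below verbatim; the ONE CALL v4's host); ADDITIVE —
imports S104 f2 `ShellMeasureLandauEndAssembledDecayCfLin` (p236622, this seat) + S94 `ShellMeasureCoTestStarShaped` (p-S94, leaf-01-g8) ONLY;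
[folklore]; ONE END theorem + ONE non-vacuity theorem + 1 example, 0 `def`, 0 `def … : Prop`, 0 sorry, 0 citation tags)

HONEST FRAMING.  Finite four-torus programme, rung (B)+1 only — NOT infinite volume, NOT a mass gap, NOT the Clay problem, NOT
summit progress; (B), `BetaPertHyp`, (B^μ) not consumed.  NE7c (`T4IndicatorShell.ShellWeightBound` for the cell's expansions) is
NOT PRINTED in [Balaban 1983–89] and NOT PROVED; «NE7c ⇐ the named binders» (trigger c3); (M1) realized ≠ NE7c.  A RE-SOURCING ON
OUR SIDE: a displayed binder of (MR)_j TYPE (census row R05, WALL §3 W-e) is replaced by a LOCATED family of the SAME TYPE as the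
slot's own classifier data (W-a: the neighbouring cubes' localized minimisers read along OUR chart contraction) plus numbers; nothing
of Bałaban's is asserted, cited or discharged; every estimate binder stays DISPLAYED.  HONEST DEPENDENCY (cell): continuum YM on T⁴ ⇐
BetaPertH ∧ nine spine estimates (0/9 proved); BetaPertH ⇐ (D1) ∧ (D4) ∧ CAP+tail; G-an2-4 gates asym, D1 and NE2/3/4.

[v6: the old module's remaining docstring paragraphs (THE POINT ∕ census expectation ∕ caveats) are ELIDED here for the
400-line limit — they stand VERBATIM in the old module in the tree and apply unchanged relative to the v6 host.]
-/

noncomputable section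

open Set Metric NormedSpace MeasureTheory Function

namespace Summit.QuantumFields.BalabanUV.T4Continuum.ShellMeasureLandauEndAssembledDecayCfLinCoTestsV6

open scoped ENNReal
open Literature.MathematicalPhysics.QuantumFieldTheory.Balaban1983to89
open B11Prop6Scheme (Prop4Hyp)
open GaugeField (GaugeInvariant)
open T4ShellMeasure (SlotAntiConcentration)
open T4CubePoincare (cube)
open T4CubeChartGnomonic (SU2)
open T4CubeChartExp (expFibreChart)
open T4TreeGaugeFixing (NoClosedLoop fixTo noClosedLoop_combBonds)
open T4ShellMeasurePlaquette (expTail₂)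
open ShellMeasureLevelAssembly (classifier)
open ShellMeasureMultiGridNorms (WSup)
open ShellMeasurePinnedNorm (pinW kerOpPin)
open ShellMeasureMultiGridNorms.WSup (toPiL)
open ShellMeasureLandauHolonomy (solAt landauExp)
open ShellMeasureLandauHolonomyChart (holOf cplx)
open ShellMeasureLandauHolonomySkew (readOutReal)
open ShellMeasureRayTermsPinnedLandauW (hE_landau_chartRay_pinned_w)
open ShellMeasureRayLogIntegral (rayBound_of_logIntegral rayBound_add)
open ShellMeasureLandauEndFinal (slotAC_realized_su2_landauChart_final)
open ShellMeasureLandauEndRayStokesAssembled (wilsonProfile_nonneg)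
open ShellMeasureDecayKernelSums (kerOp)
open ShellMeasureLandauWilsonSquaresKernelsSchwarzField (hE_landau_wilsonSquares_located_schwarz_of_decay_field)
open ShellMeasureRayTermsPinnedLandau (hE_landau_chartRay_pinned completeSpace_wsup)
open ShellMeasureLandauEndWindowRestrictRel (slotAC_realized_su2_landauChart_final_of_reach')
open T4AxialGaugeSmallField (boxPlaqs boxBonds)
open T4AxialGaugeFixing (combBonds)
open ShellMeasureWindowReachCollar (hreach'_of_core_collar)
open ShellMeasureLandauEndWindowReach (reach_family_inhabited)
open ShellMeasureLevelZeroBoxWitness (toyParams blockBonds boxPlaqF)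
open ShellMeasureLandauEndAssembledDecayReachV6 (slotAC_realized_su2_landauChart_assembled_decay_v6_of_reach')
open B7Prop2Explicit (C0 c2' unitaryUnits avgClosed_unitaryUnits)
open B7Prop1Local (pdevOn loK bondHiK)
open B7Prop5Flat (BondIn)
open ShellMeasureAverageProp4General (C1cov O1cov C2cov C1cov_pos)
open ShellMeasureLandauCorrectionB7 (landauCf landauRad)
open ShellMeasureLandauCorrectionReal (skewPi isClosed_skewPi)
open ShellMeasureLandauCfBoxLocal (landauCfBox landauCfBox_local landauCfBox_real_binders_local)
open ShellMeasureLandauCorrectionB7Local (landauCorrection_real_binders_flat landauCorrection_binders_local)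
open ShellMeasureAverageLocality148 (landauCf_congr)
open ShellMeasureLandauCfPinned (conj_binders_of_local C2cov_nonneg)
open ShellMeasureLandauEndAssembledDecayReachBoxV6 (slotAC_realized_su2_landauChart_assembled_decay_v6_of_core_collar)
open ShellMeasureLinearChartMap (hΦd_of_linear hΦ0_of_linear hΦ_of_linear hΦr_of_linear)
open ShellMeasureLandauEndAssembledDecayCfV6 (slotAC_realized_su2_landauChart_assembled_decay_v6_cfB7)
open ShellMeasureCoTestStarShaped (jco_triple_of_neighbours)
open ShellMeasureLandauEndAssembledDecayCfLinV6 (slotAC_realized_su2_landauChart_assembled_decay_v6_cfB7_lin)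

section Box

open scoped Matrix.Norms.L2Operator

variable {P : Params} {j : ℕ} [DecidableEq (PBond P j)]
variable {n : Type*} [Fintype n] [DecidableEq n] [Nonempty n]
variable {𝒴 𝒵 ℬ : Type*} [NormedAddCommGroup 𝒴] [NormedSpace ℂ 𝒴] [CompleteSpace 𝒴]
  [NormedAddCommGroup 𝒵] [NormedSpace ℂ 𝒵] [NormedAddCommGroup ℬ] [NormedSpace ℂ ℬ]
variable {𝔸 : Type*} [CStarAlgebra 𝔸] [Nontrivial 𝔸]

/-- **THE MOST-ASSEMBLED ONE-SLOT END WITH R11, R10 AND R05 SUPPLIED** — S104 f2 `…_cfB7_lin` with `W V := closedBall 0 S` and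
`Jco V :=` the neighbours' kept (2.17)-indicators on the S-ball (S94 `jco_triple_of_neighbours`): the co-test admissibility binders
`hJW hJ hJ1` and `hWS` DISCHARGED (star-shapedness from the neighbours' (AN-bound)_i + (SM)_i, DISPLAYED as `hANN hSMN` with their
numbers); (S78)'s rows over the S-ball; `hRdict` with the explicit indicator; everything else VERBATIM; conclusion IDENTICAL.
CONDITIONAL on every binder; readings NOT asserted; NOT Bałaban's minimiser (node O); (M1) realized ≠ NE7c. [folklore] -/
theorem slotAC_realized_su2_landauChart_assembled_decay_v6_cfB7_lin_coTests
    -- the BOX `[lo, hi]` (the block `□^{∼4}`: `nb` unit steps per direction, non-wrapping on the torus) and its axial comb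
    {lo hi : Fin P.d → ℤ} {nb : ℕ} (hn : ∀ κ, hi κ ≤ lo κ + nb) (hN : ∀ κ, hi κ - lo κ < P.sitesPerDir j)
    (Λ : Finset (PBond P j)) (hΛbox : ∀ b ∈ Λ, b ∈ boxBonds lo hi) (hΛcomb : Disjoint Λ (combBonds lo hi)) {m₀ : ℕ}
    (e : ↥Λ × Fin 3 ≃ Fin m₀) {S : ℝ} (hS : 0 < S) (hSπ : 3 * S ^ 2 < Real.pi ^ 2) {F : GaugeField P j SU2 → ℝ≥0∞}
    (hF : Measurable F) (hFi : GaugeInvariant F) {u : GaugeField P j SU2 → ℝ} (hu : Measurable u)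
    (hui : GaugeInvariant u) {ι : Type*} {Pu : Finset ι} (hPu : Pu.Nonempty)
    -- ══ R05 SUPPLIED (this file): window `W V := closedBall 0 S`, co-test `Jco V :=` the NEIGHBOURS' KEPT (2.17)-indicators on the
    -- S-ball (S94 `ShellMeasureCoTestStarShaped.jco_triple_of_neighbours`) — `hJW hJ hJ1 hWS` DISCHARGED; DISPLAYED in their place the
    -- per-neighbour families: neighbours `N`, plaquettes `PuN`, holonomies `holN` read on OUR chart, thresholds∕radii∕bounds∕deltas,
    -- (SM)_i in S94's currency, and (AN-bound)_i on our rays (W-a TYPE — the straddling cubes' localized minimisers; displayed) ══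
    {κN : Type*} (N : Finset κN) {ιN : κN → Type*} {PuN : (i : κN) → Finset (ιN i)} (hPuN : ∀ i, (PuN i).Nonempty)
    {AN : Type*} [NormedRing AN] [NormedAlgebra ℂ AN] [CompleteSpace AN]
    (holN : (i : κN) → GaugeField P j SU2 → ιN i → (Fin m₀ → ℝ) → AN) {θN RN HN δN : κN → ℝ} (hRN : ∀ i ∈ N, 1 < RN i)
    (hθN : ∀ i ∈ N, 0 < θN i) (hδ0N : ∀ i ∈ N, 0 ≤ δN i) (hδ1N : ∀ i ∈ N, δN i ≤ 1)
    (hSMN : ∀ i ∈ N, 36 * HN i * 1 ^ 2 / (RN i - 1) ^ 2 ≤ δN i * θN i)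
    (hANN : ∀ i ∈ N, ∀ V, ∀ x ∈ closedBall (0 : Fin m₀ → ℝ) S, ∀ p ∈ PuN i, ∃ f : ℂ → AN,
      DifferentiableOn ℂ f (ball 0 (RN i)) ∧ (∀ w ∈ ball (0 : ℂ) (RN i), ‖f w‖ ≤ HN i) ∧ f 0 = 0 ∧
      ∀ c : ℝ, 0 ≤ c → c ≤ 1 → f (c : ℂ) = holN i V p (c • x) - 1)
    {δ ρ β : ℝ} (𝒢 : GaugeField P j SU2 → (𝒵 →L[ℂ] 𝒴)) (W𝒱 : GaugeField P j SU2 → 𝒴 → 𝒵) {B₀ C₄ a₃ ε₄ : ℝ}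
    (h𝒢 : ∀ V f, ‖𝒢 V f‖ ≤ B₀ * ‖f‖) (hW : ∀ V, Prop4Hyp (W𝒱 V) C₄ a₃) (hB₀ : 0 < B₀) (hC₄ : 0 ≤ C₄) (hε₄ : 0 ≤ ε₄)
    {dL C₁ B₃ ε₁ : ℝ} (hdL : 0 ≤ dL) (hC₁ : 0 ≤ C₁) (hε₁ : 0 ≤ ε₁) (hB₃ : dL ≤ B₃) (h1 : 2 * B₀ * C₁ * B₃ * ε₁ ≤ ε₄)
    (h2 : 4 * ε₄ ≤ a₃) (h3 : 16 * B₀ * C₄ * ε₄ ≤ 1) (H₁ : GaugeField P j SU2 → (ℬ →L[ℂ] 𝒴))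
    (hH₁ : ∀ V B, ‖H₁ V B‖ ≤ B₀ * ‖B‖)
    -- ══ R10 SUPPLIED (this file): the u-tuple's coarse-datum map IS a bounded complex-LINEAR map `T V` read on the chart
    -- coordinates — its three analytic binders `hΦd hΦ0 hΦ` are DISCHARGED (`ShellMeasureLinearChartMap`); DISPLAYED in
    -- their place: ONE number relation «operator norm × polydisc radius < B11's `b = 2dLC₁ε₁`» ══
    (T : GaugeField P j SU2 → ((Fin m₀ → ℂ) →L[ℂ] ℬ)) {rΦ : ℝ} (hTb : ∀ V, ‖T V‖ * rΦ < 2 * dL * C₁ * ε₁)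
    (hSr : S < rΦ)
    -- ══ R11 SUPPLIED (row S99, γ14): the THREE Landau-correction letters ARE the tree's `C_k` of [B7] Prop. 4 in the
    -- `A`-currency (S64 `landauCf`), all with `C₂ := C2cov d`, `RC := landauRad d L`: u-tuple (LOCALIZED, flat background —
    -- its plaquette variables are words of the exponent field alone) `Cf V := (ball 0 RC).indicator (C_k(1, ·))`, NOTHING
    -- displayed in its place; w-tuple (GLOBAL minimiser, flat pi-types) `Cw V := landauCfBox L (Ubg V) k Sw Sw′ RC` (cut off
    -- PER OUTPUT BOND on its box — exact locality `hlocC` by `landauCfBox_local`); e-tuple (GLOBAL minimiser, pinned) `Ce V :=`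
    -- CfP's conjugate of `C_k(Ubg V, ·)` with `C₂e := C2cov d·e^{2δ′r₀e}`.  `hC₂ hCq hCd hCr h𝓡𝒳 ∕ hC₂w hCqw hCdw hlocC hCrw h𝓡𝒳w
    -- ∕ hC₂e hCqe hCde` DISCHARGED (f1 §5, f3a §2–§3).  DISPLAYED IN THEIR PLACE (w∕e only): the global minimiser's background
    -- `Ubg V` on `ℤᵈ` (unitary-valued) and its plaquette regularity ON THE BOXES of the two output index sets ONLY — `h52locw`,
    -- `h52loce` (B11 Thm 1 ∕ (19)–(21) TYPE, class T until node O reads it off the co-tests) — four LEVEL-FREE numbers on `α₀`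
    -- (class D), the e-letter's two pin profiles with CfP's reach `r₀e` ([R]); [dict]: `k` = the slot's level ══
    (k : ℕ) (Sf Sf' Sw Sw' : Finset (B7Prop1Explicit.Site P.d × Fin P.d))
    (Ubg : GaugeField P j SU2 → B7Prop1Explicit.Site P.d → Fin P.d → 𝔸ˣ) (hUbg : ∀ V x κ, Ubg V x κ ∈ unitaryUnits 𝔸)
    {α₀ : ℝ} (hα : 0 < α₀) (hα3 : C0 P.d * α₀ ≤ 1 / 3) (hα4 : 4 * α₀ ≤ c2' P.d P.L) (hα6 : 4 * O1cov P.d * α₀ ≤ 1 / 3)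
    (h52locw : ∀ V (c : ↥Sw'),
      pdevOn (loK P.L k c.1.1) (bondHiK P.L k c.1.1 c.1.2) (Ubg V) < α₀ * (((P.L : ℝ) ^ k)⁻¹) ^ 2)
    (ιs : GaugeField P j SU2 → (𝒴 →L[ℂ] (↥Sf → 𝔸))) (hι : ∀ V Y, ‖ιs V Y‖ ≤ ‖Y‖)
    (Hop : GaugeField P j SU2 → ((↥Sf' → 𝔸) →L[ℂ] 𝒴)) (hH : ∀ V X, ‖Hop V X‖ ≤ B₀ * ‖X‖) {ε₃ : ℝ}
    (h18 : 18 * C2cov P.d * B₀ * ε₃ ≤ 1) (hcoup : ε₄ + B₀ * (2 * dL * C₁ * ε₁) ≤ ε₃)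
    (h3R : 3 * ε₃ ≤ landauRad P.d P.L) (ℓs : ι → List (𝒴 →L[ℂ] Matrix n n ℂ)) {κr : ℝ} (hκ : 0 ≤ κr)
    (hℓ : ∀ p ∈ Pu, ∀ ℓ ∈ ℓs p, ∀ Y, ‖ℓ Y‖ ≤ κr * ‖Y‖) {m : ℕ} (hlen : ∀ p ∈ Pu, (ℓs p).length ≤ m) {κc : ℝ}
    (hκc : 0 ≤ κc) (hcurl : ∀ p ∈ Pu, ∀ Y, ‖((ℓs p).map fun ℓ => ℓ Y).sum‖ ≤ κc * ‖Y‖)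
    -- ══ (T2) THE WILSON SLOT'S SUPPLIER DATA AT THE READING OF RECORD (file 4
    -- `ShellMeasureLandauWilsonSquaresKernelsSchwarz.hE_landau_wilsonSquares_located_schwarz_of_decay`, per exterior section `V`,
    -- V-uniform constants): five FLAT pi-type chain spaces, ONE pin profile on a common position space (one-sided Lipschitz),
    -- the four linear letters as V-indexed DECAY KERNELS with reduced-rate row sums ((3.133)∕Thm 3.3, (46), (103) decay-halves
    -- TYPE — LOCATORS), the flat printed-TYPE lists, two localities with reaches, the block support of the coarse field, blind
    -- flat read-outs, the located count — NOTHING PINNED DISPLAYED; the Wilson budget LOCATED and SECOND ORDER (γ6) ══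
    {Λw Λz Λb 𝔖 : Type*} [Fintype Λw] [DecidableEq Λw] [Fintype Λz] [Fintype Λb] {𝔄w ℭ 𝔇 : Type*}
    [NormedAddCommGroup 𝔄w] [NormedSpace ℂ 𝔄w] [CompleteSpace 𝔄w] [NormedAddCommGroup ℭ] [NormedSpace ℂ ℭ]
    [NormedAddCommGroup 𝔇] [NormedSpace ℂ 𝔇] {δw : ℝ} (hδw : 0 ≤ δw) (ϖw : 𝔖 → ℝ) (dis : 𝔖 → 𝔖 → ℝ)
    (hϖw : ∀ x y, ϖw x ≤ ϖw y + dis x y) (pos : Λw → 𝔖) (posz : Λz → 𝔖) (pos' : ↥Sw → 𝔖) (posx : ↥Sw' → 𝔖)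
    (posb : Λb → 𝔖) (k𝒢 : GaugeField P j SU2 → Λw → Λz → (ℭ →L[ℂ] 𝔄w))
    (kι : GaugeField P j SU2 → ↥Sw → Λw → (𝔄w →L[ℂ] 𝔸)) (kH : GaugeField P j SU2 → Λw → ↥Sw' → (𝔸 →L[ℂ] 𝔄w))
    (kH₁ : GaugeField P j SU2 → Λw → Λb → (𝔇 →L[ℂ] 𝔄w)) {c𝒢 δ𝒢 M𝒢 cι δι Mι cH δH MH cH₁ δH₁ MH₁ : ℝ} (hc𝒢 : 0 ≤ c𝒢)
    (hM𝒢 : 0 ≤ M𝒢) (hk𝒢 : ∀ V c b', ‖k𝒢 V c b'‖ ≤ c𝒢 * Real.exp (-(δ𝒢 * dis (pos c) (posz b'))))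
    (hM𝒢' : ∀ x, ∑ b', Real.exp (-((δ𝒢 - δw) * dis x (posz b'))) ≤ M𝒢) (hcι : 0 ≤ cι) (hMι : 0 ≤ Mι)
    (hkι : ∀ V c b', ‖kι V c b'‖ ≤ cι * Real.exp (-(δι * dis (pos' c) (pos b'))))
    (hMι' : ∀ x, ∑ b', Real.exp (-((δι - δw) * dis x (pos b'))) ≤ Mι) (hcH : 0 ≤ cH) (hMH : 0 ≤ MH)
    (hkH : ∀ V c b', ‖kH V c b'‖ ≤ cH * Real.exp (-(δH * dis (pos c) (posx b'))))
    (hMH' : ∀ x, ∑ b', Real.exp (-((δH - δw) * dis x (posx b'))) ≤ MH) (hcH₁ : 0 ≤ cH₁) (hMH₁ : 0 ≤ MH₁)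
    (hkH₁ : ∀ V c b', ‖kH₁ V c b'‖ ≤ cH₁ * Real.exp (-(δH₁ * dis (pos c) (posb b'))))
    (hMH₁' : ∀ x, ∑ b', Real.exp (-((δH₁ - δw) * dis x (posb b'))) ≤ MH₁)
    -- the flat lists (P2)∕(P4)∕(118)∕(121)∕(103)∕(75)-TYPE∕(44) at radius `RCw` with `6(ε₄w + B₀w·bw) ≤ RCw`∕scaling∕(46)∕(54)
    (W𝒱w : GaugeField P j SU2 → (Λw → 𝔄w) → (Λz → ℭ)) {B₀w C₄w a₃w ε₄w bw : ℝ}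
    (h𝒢w : ∀ V f, ‖kerOp (k𝒢 V) f‖ ≤ B₀w * ‖f‖) (hWw : ∀ V, Prop4Hyp (W𝒱w V) C₄w a₃w) (hB₀w : 0 < B₀w)
    (hC₄w : 0 ≤ C₄w) (hε₄w : 0 ≤ ε₄w) (hdomw : 2 * (ε₄w + B₀w * bw) ≤ a₃w)
    (hselfw : B₀w * C₄w * (ε₄w + B₀w * bw) ^ 2 ≤ ε₄w) (hcontrw : 4 * B₀w * C₄w * (ε₄w + B₀w * bw) < 1)
    (hH₁w : ∀ V B, ‖kerOp (kH₁ V) B‖ ≤ B₀w * ‖B‖)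
    -- ══ R10 SUPPLIED: the w-tuple's coarse-datum map is a bounded LINEAR map into the flat pi-type; ONE number relation ══
    (Tw : GaugeField P j SU2 → ((Fin m₀ → ℂ) →L[ℂ] (Λb → 𝔇))) {rΦw : ℝ} (hTbw : ∀ V, ‖Tw V‖ * rΦw < bw)
    (h2Sw : 2 * S ≤ rΦw) (hιw : ∀ V Y, ‖kerOp (kι V) Y‖ ≤ ‖Y‖) (hHw : ∀ V X, ‖kerOp (kH V) X‖ ≤ B₀w * ‖X‖)
    (hqw : 9 * C2cov P.d * B₀w * (ε₄w + B₀w * bw) < 1) (hRCw : 6 * (ε₄w + B₀w * bw) ≤ landauRad P.d P.L)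
    -- localities with reaches, the block support, the two contraction numbers (DISPLAYED arithmetic on the decay constants)
    (NW : Λz → Λw → Prop)
    (hlocW : ∀ V, ∀ A A' : Λw → 𝔄w, ∀ c', (∀ b', NW c' b' → A b' = A' b') → W𝒱w V A c' = W𝒱w V A' c') {rW : ℝ}
    (hreachW : ∀ c' b', NW c' b' → ϖw (posz c') - rW ≤ ϖw (pos b')) {rC : ℝ}
    (hreachC : ∀ (c' : ↥Sw') (b' : ↥Sw),
      BondIn (loK P.L k c'.1.1) (bondHiK P.L k c'.1.1 c'.1.2) b'.1.1 b'.1.2 → ϖw (posx c') - rC ≤ ϖw (pos' b'))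
    (hsupp : ∀ V, ∀ z : Fin m₀ → ℂ, ∀ i, 0 < ϖw (posb i) → Tw V z i = 0)
    (hqW : c𝒢 * M𝒢 * (4 * C₄w * (ε₄w + B₀w * bw) * Real.exp (δw * rW)) < 1)
    (hk : 12 * C2cov P.d * (ε₄w + B₀w * bw) * Real.exp (δw * rC) * (cι * Mι) * (cH * MH) < 1)
    -- weight plaquettes; read-outs BLIND off located supports, FLAT op-norms, curl op-norm (DISPLAYED; `κ_c ∝ η²`), lengths
    {𝔭 : Type*} (Pw : Finset 𝔭) (ℓw : 𝔭 → List ((Λw → 𝔄w) →L[ℂ] Matrix n n ℂ)) (suppw : 𝔭 → Finset Λw) (ϖPw : 𝔭 → ℝ)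
    (hblindw : ∀ p ∈ Pw, ∀ ℓ ∈ ℓw p, ∀ A A' : Λw → 𝔄w, (∀ b' ∈ suppw p, A b' = A' b') → ℓ A = ℓ A')
    (hdepthw : ∀ p ∈ Pw, ∀ b' ∈ suppw p, ϖPw p ≤ ϖw (pos b')) (hϖPw : ∀ p ∈ Pw, 0 ≤ ϖPw p) {κwb κcb : ℝ}
    (hκwb : 0 ≤ κwb) (hκcb : 0 ≤ κcb) (hℓwb : ∀ p ∈ Pw, ∀ ℓ ∈ ℓw p, ‖ℓ‖ ≤ κwb) (hcurlw : ∀ p ∈ Pw, ‖(ℓw p).sum‖ ≤ κcb)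
    {mw : ℕ} (hlenw : ∀ p ∈ Pw, (ℓw p).length ≤ mw)
    -- the global tuple's real structure with SKEW weight read-outs
    (𝓡𝒴w : AddSubgroup (Λw → 𝔄w)) (h𝓡𝒴w : IsClosed (𝓡𝒴w : Set (Λw → 𝔄w))) (𝓡𝒵w : AddSubgroup (Λz → ℭ))
    (𝓡ℬw : AddSubgroup (Λb → 𝔇)) (h𝒢rw : ∀ V, ∀ f ∈ 𝓡𝒵w, kerOp (k𝒢 V) f ∈ 𝓡𝒴w) (hWrw : ∀ V, ∀ Y ∈ 𝓡𝒴w, W𝒱w V Y ∈ 𝓡𝒵w)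
    (hιrw : ∀ V, ∀ Y ∈ 𝓡𝒴w, kerOp (kι V) Y ∈ skewPi ↥Sw)
    (hHrw : ∀ V, ∀ X ∈ skewPi (𝔸 := 𝔸) ↥Sw', kerOp (kH V) X ∈ 𝓡𝒴w) (hH₁rw : ∀ V, ∀ B ∈ 𝓡ℬw, kerOp (kH₁ V) B ∈ 𝓡𝒴w)
    (hTrw : ∀ V (y : Fin m₀ → ℝ), Tw V (cplx y) ∈ 𝓡ℬw)
    (hskew : ∀ p ∈ Pw, ∀ ℓ ∈ ℓw p, ∀ Y ∈ 𝓡𝒴w, ℓ Y ∈ skewAdjoint (Matrix n n ℂ))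
    -- the frozen background plaquettes (N-ne7cp1-g31-2) with a uniform size bound, the located count, `0 ≤ β`
    (Bp : GaugeField P j SU2 → 𝔭 → Matrix n n ℂ) {d : 𝔭 → ℝ} {dbar : ℝ}
    (hBu : ∀ V, ∀ p ∈ Pw, Bp V p ∈ unitary (Matrix n n ℂ)) (hBd : ∀ V, ∀ p ∈ Pw, ‖Bp V p - 1‖ ≤ d p)
    (hd : ∀ p ∈ Pw, d p ≤ dbar) (hdbar : 0 ≤ dbar) {Kw : ℝ} (hKw : ∑ p ∈ Pw, Real.exp (-(δw * ϖPw p)) ≤ Kw)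
    -- ══ (T3) THE LOCATED NON-WILSON TERMS — THE 𝓔-LEG READ OFF THE w-TUPLE's KERNELS IN THE PINNED DRESS (S113, leaf-01-g11:
    -- `hE_landau_chartRay_pinned_w`): ONE exponent field; the e-tuple's carriers and letters are GONE; ENTERING the pin sign, the three
    -- Schur number junctions (S108's rows, born here) and the pinned restriction row; the e-leg's own numbers, its Landau-correction
    -- pair (between the pinned spaces), the TERM rows and the coupling STAY ══
    (hϖ0 : ∀ x, 0 ≤ ϖw x) (hB𝒢w : c𝒢 * M𝒢 ≤ B₀w) (hBH₁w : cH₁ * MH₁ ≤ B₀w) (hBHw : cH * MH ≤ B₀w) {ε₄e : ℝ}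
    (hε₄e : 0 ≤ ε₄e) (hdome : 2 * (ε₄e + B₀w * bw) ≤ a₃w)
    (hselfe : B₀w * (C₄w * Real.exp (δw * rW)) * (ε₄e + B₀w * bw) ^ 2 ≤ ε₄e)
    (hcontre : 4 * B₀w * (C₄w * Real.exp (δw * rW)) * (ε₄e + B₀w * bw) < 1)
    (hιew : ∀ V, ∀ Y : WSup (pinW δw (ϖw ∘ pos)) 1 𝔄w, ‖kerOpPin (kι V) δw (ϖw ∘ pos) (ϖw ∘ pos') Y‖ ≤ ‖Y‖)
    (hqe : 9 * (C2cov P.d * Real.exp (2 * δw * rC)) * B₀w * (ε₄e + B₀w * bw) < 1)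
    (hRCe : 3 * (ε₄e + B₀w * bw) ≤ landauRad P.d P.L) {𝔱 : Type*} (I : Finset 𝔱) {Ef : 𝔱 → (Λw → 𝔄w) → ℂ} {rE : ℝ}
    {ee : 𝔱 → ℝ} (hrE : 0 < rE) (hEd : ∀ i ∈ I, DifferentiableOn ℂ (Ef i) (ball 0 rE))
    (hEb : ∀ i ∈ I, ∀ Z ∈ ball (0 : Λw → 𝔄w) rE, ‖Ef i Z‖ ≤ ee i) (he0 : ∀ i ∈ I, 0 ≤ ee i) (supp : 𝔱 → Finset Λw)
    (hblind : ∀ i ∈ I, ∀ A₁ A₂ : Λw → 𝔄w, (∀ b' ∈ supp i, A₁ b' = A₂ b') → Ef i A₁ = Ef i A₂) (ϖP : 𝔱 → ℝ)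
    (hdepth : ∀ i ∈ I, ∀ b' ∈ supp i, ϖP i ≤ ϖw (pos b')) {LK : ℝ} (hLK : 0 ≤ LK)
    (hK : ∑ i ∈ I, 2 * ee i / rE * Real.exp (-(δw * ϖP i)) ≤ LK)
    (hcoupE : ((ε₄e + B₀w * bw) + B₀w * (4 * (C2cov P.d * Real.exp (2 * δw * rC)) * (ε₄e + B₀w * bw) ^ 2)) ≤ rE / 2)
    {BE₁ : ℝ}
    (hElb₁ : ∀ V (y : Fin m₀ → ℝ), ‖y‖ ≤ S → -BE₁ ≤
      (∑ i ∈ I, Ef i (WSup.toPiL (pinW δw (ϖw ∘ pos)) 1 (landauExp (fun Y : WSup (pinW δw (ϖw ∘ pos')) 1 𝔸 =>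
            ((toPiL (pinW δw (ϖw ∘ posx)) 1).symm (landauCfBox P.L (Ubg V) k Sw Sw' (landauRad P.d P.L) (toPiL (pinW δw (ϖw ∘ pos')) 1 Y)) :
              WSup (pinW δw (ϖw ∘ posx)) 1 𝔸))
        (kerOpPin (kι V) δw (ϖw ∘ pos) (ϖw ∘ pos')) (kerOpPin (kH V) δw (ϖw ∘ posx) (ϖw ∘ pos))
        (4 * (C2cov P.d * Real.exp (2 * δw * rC)) * (ε₄e + B₀w * bw) ^ 2)
        (solAt (kerOpPin (k𝒢 V) δw (ϖw ∘ posz) (ϖw ∘ pos)) 0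
          (fun Y : WSup (pinW δw (ϖw ∘ pos)) 1 𝔄w =>
            ((toPiL (pinW δw (ϖw ∘ posz)) 1).symm (W𝒱w V (toPiL (pinW δw (ϖw ∘ pos)) 1 Y)) : WSup (pinW δw (ϖw ∘ posz)) 1 ℭ))
          ε₄e (0 : WSup (pinW δw (ϖw ∘ posz)) 1 ℭ)
          (kerOpPin (kH₁ V) δw (ϖw ∘ posb) (ϖw ∘ pos) ((toPiL (pinW δw (ϖw ∘ posb)) 1).symm (Tw V (cplx y)))) +
            kerOpPin (kH₁ V) δw (ϖw ∘ posb) (ϖw ∘ pos) ((toPiL (pinW δw (ϖw ∘ posb)) 1).symm (Tw V (cplx y))))))).re)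
    -- ══ (S78) THE FLUCTUATION-DRESSED TERMS: `−log ∫ g e^{A} dμ` with an ω-UNIFORM ray constant `B_d`, integrability and
    -- positivity of the dressed integral, a lower bound on the S-ball (all DISPLAYED) ══
    {Ω : Type*} [MeasurableSpace Ω] (μ : Measure Ω) {g : Ω → ℝ} (hg : ∀ ω, 0 ≤ g ω)
    (A : GaugeField P j SU2 → (Fin m₀ → ℝ) → Ω → ℝ) {Bd : ℝ} (hBd0 : 0 ≤ Bd)
    (hint : ∀ V, ∀ x ∈ closedBall (0 : Fin m₀ → ℝ) S, ∀ c : ℝ, 1 / 2 ≤ c → c ≤ 1 →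
      Integrable (fun ω => g ω * Real.exp (A V (c • x) ω)) μ)
    (hpos : ∀ V, ∀ x ∈ closedBall (0 : Fin m₀ → ℝ) S, ∀ c : ℝ, 1 / 2 ≤ c → c ≤ 1 →
      0 < ∫ ω, g ω * Real.exp (A V (c • x) ω) ∂μ)
    (hA : ∀ V, ∀ x ∈ closedBall (0 : Fin m₀ → ℝ) S, ∀ c : ℝ, 1 / 2 ≤ c → c ≤ 1 →
      ∀ ω, A V x ω ≤ A V (c • x) ω + (1 - c) * Bd)
    {BE₂ : ℝ} (hElb₂ : ∀ V (y : Fin m₀ → ℝ), ‖y‖ ≤ S → -BE₂ ≤ (-Real.log (∫ ω, g ω * Real.exp (A V y ω) ∂μ)))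
    (L : Set (𝒴 →L[ℂ] Matrix n n ℂ)) (𝓡𝒵 : AddSubgroup 𝒵) (𝓡ℬ : AddSubgroup ℬ)
    (h𝒢r : ∀ V, ∀ f ∈ 𝓡𝒵, 𝒢 V f ∈ readOutReal L) (hWr : ∀ V, ∀ Y ∈ readOutReal L, W𝒱 V Y ∈ 𝓡𝒵)
    (hιr : ∀ V, ∀ Y ∈ readOutReal L, ιs V Y ∈ skewPi ↥Sf)
    (hHr : ∀ V, ∀ X ∈ skewPi (𝔸 := 𝔸) ↥Sf', Hop V X ∈ readOutReal L) (hH₁r : ∀ V, ∀ B ∈ 𝓡ℬ, H₁ V B ∈ readOutReal L)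
    (hTr : ∀ V (y : Fin m₀ → ℝ), T V (cplx y) ∈ 𝓡ℬ)
    (hudict : ∀ V, ∀ x ∈ cube m₀ S,
      u (fixTo (combBonds lo hi) 1 (updateFinset V Λ (expFibreChart Λ 1 e x))) =
        classifier hPu (fun p => holOf (ℓs p) (fun y => landauExp ((ball (0 : ↥Sf → 𝔸) (landauRad P.d P.L)).indicator
            (landauCf P.L (1 : B7Prop1Explicit.Site P.d → Fin P.d → 𝔸ˣ) k Sf Sf')) (ιs V) (Hop V)
          (4 * C2cov P.d * (ε₄ + B₀ * (2 * dL * C₁ * ε₁)) ^ 2)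
          (solAt (𝒢 V) 0 (W𝒱 V) ε₄ (0 : 𝒵) (H₁ V (T V (cplx y))) + H₁ V (T V (cplx y))))) x)
    (hRdict : ∀ V, ∀ x ∈ cube m₀ S, F (fixTo (combBonds lo hi) 1 (updateFinset V Λ (expFibreChart Λ 1 e x))) =
      (closedBall (0 : Fin m₀ → ℝ) S ∩ ⋂ i ∈ N, {y | classifier (hPuN i) (holN i V) y < θN i}).indicator (1 :
      (Fin m₀ → ℝ) → ℝ≥0∞) x * ENNReal.ofReal (Real.exp (-((∑ p ∈ Pw, β * (1 - (Matrix.trace (Bp V p * holOf (ℓw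
      p) (fun y => landauExp (landauCfBox P.L (Ubg V) k Sw Sw' (landauRad P.d P.L)) (kerOp (kι V)) (kerOp (kH
      V)) (4 * C2cov P.d * (ε₄w + B₀w * bw) ^ 2) (solAt (kerOp (k𝒢 V)) 0 (W𝒱w V) ε₄w (0 : Λz → ℭ) (kerOp (kH₁ V)
      (Tw V (cplx y))) + kerOp (kH₁ V) (Tw V (cplx y)))) x)).re / Fintype.card n)) + ((∑ i ∈ I, Ef i (WSup.toPiL
      (pinW δw (ϖw ∘ pos)) 1 (landauExp (fun Y : WSup (pinW δw (ϖw ∘ pos')) 1 𝔸 => ((toPiL (pinW δw (ϖw ∘ posx))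
      1).symm (landauCfBox P.L (Ubg V) k Sw Sw' (landauRad P.d P.L) (toPiL (pinW δw (ϖw ∘ pos')) 1 Y)) : WSup
      (pinW δw (ϖw ∘ posx)) 1 𝔸)) (kerOpPin (kι V) δw (ϖw ∘ pos) (ϖw ∘ pos')) (kerOpPin (kH V) δw (ϖw ∘ posx)
      (ϖw ∘ pos)) (4 * (C2cov P.d * Real.exp (2 * δw * rC)) * (ε₄e + B₀w * bw) ^ 2) (solAt (kerOpPin (k𝒢 V) δw
      (ϖw ∘ posz) (ϖw ∘ pos)) 0 (fun Y : WSup (pinW δw (ϖw ∘ pos)) 1 𝔄w => ((toPiL (pinW δw (ϖw ∘ posz)) 1).symm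
      (W𝒱w V (toPiL (pinW δw (ϖw ∘ pos)) 1 Y)) : WSup (pinW δw (ϖw ∘ posz)) 1 ℭ)) ε₄e (0 : WSup (pinW δw (ϖw ∘
      posz)) 1 ℭ) (kerOpPin (kH₁ V) δw (ϖw ∘ posb) (ϖw ∘ pos) ((toPiL (pinW δw (ϖw ∘ posb)) 1).symm (Tw V (cplx
      x)))) + kerOpPin (kH₁ V) δw (ϖw ∘ posb) (ϖw ∘ pos) ((toPiL (pinW δw (ϖw ∘ posb)) 1).symm (Tw V (cplx
      x))))))).re + (-Real.log (∫ ω, g ω * Real.exp (A V x ω) ∂μ)))))))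
    (hδ0 : 0 ≤ δ) (hδ1 : δ < 1) (hρ0 : 0 ≤ ρ) (hρ : ρ ≤ (1 - δ) / 2) (hβ : 0 ≤ β)
    -- SM-L2 (SM) DISCHARGED IN THE STOKES CURRENCY (S73 `hSM_of_stokes`): the η-scalings of the classifier's read-out data
    -- DISPLAYED — curl read-out × field size `κ_c·z̄ ≤ c₁η²z` (B11 (25)∕(37) TYPE), letter size `κ_r·z̄ ≤ c₂ηz` ((19) TYPE),
    -- regime `m·κ_r·z̄ ≤ 1` — the UNIT-currency smallness `36(c₁z + m²c₂²z²)∕(r_Φ∕S − 1)² ≤ δ·εθ`, and the classifier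
    -- threshold `θ := εθ·η²` (B14 (2.17) TYPE): the `η²` CANCELS
    {η εθ c₁ c₂ z : ℝ} (hη : 0 < η) (hεθ : 0 < εθ)
    (hs₁ : κc * ((ε₄ + B₀ * (2 * dL * C₁ * ε₁)) + B₀ * (4 * C2cov P.d * (ε₄ + B₀ * (2 * dL * C₁ * ε₁)) ^ 2)) ≤ c₁ * η ^ 2 * z)
    (ha : κr * ((ε₄ + B₀ * (2 * dL * C₁ * ε₁)) + B₀ * (4 * C2cov P.d * (ε₄ + B₀ * (2 * dL * C₁ * ε₁)) ^ 2)) ≤ c₂ * η * z)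
    (hma : m * (κr * ((ε₄ + B₀ * (2 * dL * C₁ * ε₁)) + B₀ * (4 * C2cov P.d * (ε₄ + B₀ * (2 * dL * C₁ * ε₁)) ^ 2))) ≤ 1)
    (hsm : 36 * (c₁ * z + m ^ 2 * c₂ ^ 2 * z ^ 2) / (rΦ / S - 1) ^ 2 ≤ δ * εθ)
    -- THE DISPLAYED γ3 INPUT OF RECORD (N-ne7cp1-g32-2 ∕ N-ne7cp1-g33-2 «COLLAR»; leaf-01-g8 l.18489, leaf-08-g14 l.18568):
    -- radius `(d−1)·nb·a ≤ 2 sin(S∕2)`, a cover of the box plaquettes by a CORE set (⊇ the plaquettes of `□^∼`) and a COLLAR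
    -- set, and the PAIR of readings — «sub-threshold ⟹ core plaquettes `a`-small» (B14 (2.16)–(2.17) + average regularity
    -- [Balaban1985Averaging] Props 1∕2 TYPE, from `u < θ`) and «`F ≠ 0` ⟹ collar plaquettes `a`-small» (the density's KEPT
    -- co-tests, B15 (1.3)–(1.9) TYPE — a SUPPORT property); located, NOT asserted — REPLACE `hreach′` of file 1 (hence
    -- `hFsupp` of S80 f3); binder NAMES = S87 f4's (`hn hN hΛbox hΛcomb ha0 hrad hcover hcore hcollar`; the two plaquette
    -- sets are called `Pcore`∕`Pcollar` here because S80 f3 already uses `A` for the (S78) dressed action)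
    {a : ℝ} (ha0 : 0 ≤ a) (hrad : ((P.d - 1 : ℕ) : ℝ) * nb * a ≤ 2 * Real.sin (S / 2))
    {Pcore Pcollar : Set (Plaq P j)} (hcover : boxPlaqs lo hi ⊆ Pcore ∪ Pcollar)
    (hcore : ∀ (V : GaugeField P j SU2) (y : ↥Λ → SU2),
      u (fixTo (combBonds lo hi) 1 (updateFinset V Λ y)) < εθ * η ^ 2 →
        PlaqSmallOn Pcore a (fixTo (combBonds lo hi) 1 (updateFinset V Λ y)))
    (hcollar : ∀ (V : GaugeField P j SU2) (y : ↥Λ → SU2),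
      F (fixTo (combBonds lo hi) 1 (updateFinset V Λ y)) ≠ 0 →
        PlaqSmallOn Pcollar a (fixTo (combBonds lo hi) 1 (updateFinset V Λ y))) :
    SlotAntiConcentration ((fieldMeasure P j SU2).withDensity F) u (εθ * η ^ 2) ρ
      (2 * ((m₀ : ℝ) + (3 * (|β| * ((dbar +
          2 * (κcb * (cH₁ * MH₁ * bw / ((1 - c𝒢 * M𝒢 * (4 * C₄w * (ε₄w + B₀w * bw) * Real.exp (δw * rW))) *
              (1 - 12 * C2cov P.d * (ε₄w + B₀w * bw) * Real.exp (δw * rC) * (cι * Mι) * (cH * MH)))) +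
            expTail₂ (mw * (κwb * (cH₁ * MH₁ * bw / ((1 - c𝒢 * M𝒢 * (4 * C₄w * (ε₄w + B₀w * bw) * Real.exp (δw * rW))) *
              (1 - 12 * C2cov P.d * (ε₄w + B₀w * bw) * Real.exp (δw * rC) * (cι * Mι) * (cH * MH))))))) / (rΦw / S)) *
          (2 * (κcb * (cH₁ * MH₁ * bw / ((1 - c𝒢 * M𝒢 * (4 * C₄w * (ε₄w + B₀w * bw) * Real.exp (δw * rW))) *
              (1 - 12 * C2cov P.d * (ε₄w + B₀w * bw) * Real.exp (δw * rC) * (cι * Mι) * (cH * MH)))) +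
            expTail₂ (mw * (κwb * (cH₁ * MH₁ * bw / ((1 - c𝒢 * M𝒢 * (4 * C₄w * (ε₄w + B₀w * bw) * Real.exp (δw * rW))) *
              (1 - 12 * C2cov P.d * (ε₄w + B₀w * bw) * Real.exp (δw * rC) * (cι * Mι) * (cH * MH))))))) / (rΦw / S))) * Kw) +
        (3 * (LK * (2 * ((ε₄e + B₀w * bw) + B₀w * (4 * (C2cov P.d * Real.exp (2 * δw * rC)) * (ε₄e + B₀w * bw) ^ 2)))) / (rΦw / S - 1) + Bd))) / (1 - δ)) := by
  have hco := jco_triple_of_neighbours (𝒱 := GaugeField P j SU2) (S := S) N hPuN holN hRN hθN hδ0N hδ1N hSMN hANN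
  exact slotAC_realized_su2_landauChart_assembled_decay_v6_cfB7_lin hn hN Λ hΛbox hΛcomb e hS hSπ hF hFi hu hui hPu (fun _
    => closedBall (0 : Fin m₀ → ℝ) S) (fun V x => (closedBall (0 : Fin m₀ → ℝ) S ∩ ⋂ i ∈ N, {y | classifier (hPuN i)
    (holN i V) y < θN i}).indicator       (1 : (Fin m₀ → ℝ) → ℝ≥0∞) x) 𝒢 W𝒱 h𝒢 hW hB₀ hC₄ hε₄ hdL hC₁ hε₁ hB₃ h1 h2 h3
    H₁ hH₁ T hTb hSr k Sf Sf' Sw Sw' Ubg hUbg hα hα3 hα4 hα6 h52locw ιs hι Hop hH h18 hcoup h3R ℓs hκ hℓ hlen hκc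
    hcurl hδw ϖw dis hϖw pos posz pos' posx posb k𝒢 kι kH kH₁ hc𝒢 hM𝒢 hk𝒢 hM𝒢' hcι hMι hkι hMι' hcH hMH hkH hMH' hcH₁
    hMH₁ hkH₁ hMH₁' W𝒱w h𝒢w hWw hB₀w hC₄w hε₄w hdomw hselfw hcontrw hH₁w Tw hTbw h2Sw hιw hHw hqw hRCw NW hlocW
    hreachW hreachC hsupp hqW hk Pw ℓw suppw ϖPw hblindw hdepthw hϖPw hκwb hκcb hℓwb hcurlw hlenw 𝓡𝒴w h𝓡𝒴w 𝓡𝒵w 𝓡ℬw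
    h𝒢rw hWrw hιrw hHrw hH₁rw hTrw hskew Bp hBu hBd hd hdbar hKw hϖ0 hB𝒢w hBH₁w hBHw hε₄e hdome hselfe hcontre hιew
    hqe hRCe I hrE hEd hEb he0 supp hblind ϖP hdepth hLK hK hcoupE hElb₁ μ hg A hBd0 hint hpos hA hElb₂ L 𝓡𝒵 𝓡ℬ h𝒢r
    hWr hιr hHr hH₁r hTr hudict hRdict hco.1 hco.2.1 hco.2.2.1 hco.2.2.2 hδ0 hδ1 hρ0 hρ hβ hη hεθ hs₁ ha hma hsm ha0
    hrad hcover hcore hcollar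

end Box

/-! ## §2 Non-vacuity of the entering co-test family (crew rule G-1, owner item (3)) -/

section NonVacuity

-- v6 COURIER DEDUP NOTE (leaf-08-g17, gate `dedup.landed` on p246467): the joint-inhabitation witness of this family,
-- `coTest_family_inhabited`, is ALREADY LANDED verbatim as
-- `ShellMeasureLandauEndAssembledDecayCfLinCoTests.coTest_family_inhabited` (S104 f4, the v5-era link) and is NOT restated
-- here; cite it by that name.  The example below (S94 by name) is unchanged.

/-- … and at that datum the co-test does not vanish identically (S94 §4, by name). [folklore] -/
example {m₀ : ℕ} {S : ℝ} (hS : 0 ≤ S) :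
    (closedBall (0 : Fin m₀ → ℝ) S ∩ ⋂ i ∈ ({()} : Finset Unit), {y : Fin m₀ → ℝ |
        classifier (Finset.singleton_nonempty ()) (fun (_ : Unit) (_ : Fin m₀ → ℝ) => (1 : ℂ)) y < (fun _ => (1 : ℝ)) i}).indicator
        (1 : (Fin m₀ → ℝ) → ℝ≥0∞) 0 ≠ 0 :=
  (ShellMeasureCoTestStarShaped.one_neighbour_inhabited (m₀ := m₀) hS).2

end NonVacuity

end Summit.QuantumFields.BalabanUV.T4Continuum.ShellMeasureLandauEndAssembledDecayCfLinCoTestsV6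

end
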